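import Mathlib.Combinatorics.SimpleGraph.Metric
import Mathlib.GroupTheory.FreeGroup.IsFreeGroup
import Mathlib.GroupTheory.FreeGroup.CyclicallyReduced
import Mathlib.GroupTheory.Index
import Mathlib.CategoryTheory.Endomorphism
import Mathlib.GroupTheory.Finiteness
import Literature.AnabelianGeometry.SemiGraphs.SemiGraph

/-!
# Free groups and finite group actions on semi-graphs ([SemiAnbd] §1, Cor. 1.6 – Remark 1.8.1, pp. 19–21)

Mochizuki, *Semi-graphs of anabelioids*, Publ. RIMS **42** (2006) 221–322, §1, author's manuscript
pp. 19–21 [cite: MochizukiSemiAnbd2006, §1 pp.19-21]: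

* Corollary 1.6 (Finitely generated subgroups of finite rank free groups; A. Tamagawa): (ii) "there
  exists a finite index subgroup `H ⊆ G` such that `H` contains `F`, and … free generators
  `γ_1, …, γ_r` of `H` with the property that for some `s ≤ r`, `γ_1, …, γ_s` form a set of free
  generators of `F`" — NAMED FACT (over Mathlib `FreeGroupBasis`);
* Corollary 1.7 (Residual finiteness of free groups): "every discrete free group `F` injects into its
  profinite completion", rendered as residual finiteness — NAMED FACT; Remark 1.7.1 (the pro-`l`
  version, [RZ] Prop. 3.3.15) — NAMED FACT;
* Lemma 1.8 (Finite group actions on semi-graphs; "implicit in the theory of [Serre]") (i),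
  (ii)(a),(b),(c) — NAMED FACTS; Remark 1.8.1 ("a free group does not contain any nontrivial finite
  subgroups", [Serre] I.3.4 Thm 5) — PROVED from Mathlib's torsion-freeness of free groups.

Rendering.  An action of a group `Γ` on a semi-graph `G` is a homomorphism `Γ →* Aut G` into the
automorphism group of `G` in the category of semi-graphs.  A "geodesic" (Lemma 1.8 (ii)(b): "path
of closed edges of minimal length") joining two vertices is a walk of minimal length between them
in the barycentric subdivision (its intermediate edges are automatically closed); "acts trivially
on the geodesic" = fixes every vertex, edge and branch on it.

Deliberately NOT here: Corollary 1.6 (i) ("there exists an immersion of finite graphs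
`φ : G_A → G_B` whose induced morphism on (topological) fundamental groups is isomorphic to the
inclusion `F ↪ G`") — it needs the fundamental group of a finite graph and its functoriality under
immersions, not yet in the tree; the profinite completion as an object (Cor. 1.7 is stated as
residual finiteness, which is what its proof shows).
-/

namespace Literature.AnabelianGeometry.SemiGraphs

open CategoryTheory

universe u

/-! ### Corollaries 1.6 and 1.7 (pp. 19–20) -/

/-- NAMED FACT, [SemiAnbd] Corollary 1.6 (ii) (A. Tamagawa): for a finitely generated subgroup `F` of
a free group `G` of finite rank, "there exists a finite index subgroup `H ⊆ G` such that `H` contains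
`F`, and, moreover, there exists a set of free generators `γ_1, …, γ_r` of `H` with the property that
for some `s ≤ r`, `γ_1, …, γ_s` form a set of free generators of `F`" — the basis of `H` is indexed by
`κ₁ ⊕ κ₂` with the `κ₁`-part a basis of `F`. [cite: MochizukiSemiAnbd2006, Cor. 1.6(ii) p.19] -/
def corollary_1_6_ii : Prop :=
  ∀ (G : Type u) [Group G] (ι : Type u) [Finite ι] (_bG : FreeGroupBasis ι G) (F : Subgroup G),
    F.FG → ∃ (H : Subgroup G), H.FiniteIndex ∧ F ≤ H ∧
      ∃ (κ₁ κ₂ : Type u) (_ : Finite κ₁) (_ : Finite κ₂) (bH : FreeGroupBasis (κ₁ ⊕ κ₂) H)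
        (bF : FreeGroupBasis κ₁ F), ∀ i : κ₁, (bF i : G) = (bH (Sum.inl i) : G)

/-- NAMED FACT, [SemiAnbd] Corollary 1.7 (Residual Finiteness of Free Groups): "Every discrete free
group `F` injects into its profinite completion", i.e. every nontrivial element lies outside some
normal subgroup of finite index. [cite: MochizukiSemiAnbd2006, Cor. 1.7 p.20] -/
def corollary_1_7 : Prop :=
  ∀ (ι : Type u) (x : FreeGroup ι), x ≠ 1 →
    ∃ N : Subgroup (FreeGroup ι), N.Normal ∧ N.FiniteIndex ∧ x ∉ N

/-- NAMED FACT, [SemiAnbd] Remark 1.7.1: "there is also a pro-`l` version of this residual finiteness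
result — cf., e.g., [RZ], Proposition 3.3.15": every nontrivial element of a free group lies outside
some normal subgroup of index a power of the prime `l`. [cite: MochizukiSemiAnbd2006, Rem. 1.7.1 p.20] -/
def remark_1_7_1 : Prop :=
  ∀ (ι : Type u) (l : ℕ), l.Prime → ∀ x : FreeGroup ι, x ≠ 1 →
    ∃ (N : Subgroup (FreeGroup ι)) (k : ℕ), N.Normal ∧ N.index = l ^ k ∧ x ∉ N

/-! ### Lemma 1.8: finite group actions on semi-graphs (pp. 20–21) -/

namespace SemiGraph

variable {G : SemiGraph.{u}} {Γ : Type u} [Group Γ]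

/-- The image of a sub-semi-graph under an automorphism of `G`. [cite: MochizukiSemiAnbd2006, Lem. 1.8 p.20] -/
def Subgraph.image (H : G.Subgraph) (σ : Aut G) : G.Subgraph where
  verts := σ.hom.vertexMap '' H.verts
  edges := σ.hom.edgeMap '' H.edges

/-- A sub-semi-graph is *stabilized* by an action `ρ : Γ →* Aut G` (Lemma 1.8 (i)).
[cite: MochizukiSemiAnbd2006, Lem. 1.8(i) p.20] -/
def Subgraph.IsStabilized (H : G.Subgraph) (ρ : Γ →* Aut G) : Prop := ∀ γ : Γ, H.image (ρ γ) = H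

/-- A sub-semi-graph is *finite* (finitely many vertices and edges; Lemma 1.8 (i)).
[cite: MochizukiSemiAnbd2006, Lem. 1.8(i) p.20] -/
def Subgraph.IsFinite (H : G.Subgraph) : Prop := H.verts.Finite ∧ H.edges.Finite

/-- Containment of sub-semi-graphs. [cite: MochizukiSemiAnbd2006, Lem. 1.8(i) p.20] -/
def Subgraph.IsContainedIn (H H' : G.Subgraph) : Prop := H.verts ⊆ H'.verts ∧ H.edges ⊆ H'.edges

/-- The action of an automorphism of `G` on the points of the barycentric subdivision (vertices,
edges, branches). [cite: MochizukiSemiAnbd2006, Lem. 1.8(ii) p.20] -/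
def nodeMap (σ : Aut G) : G.Node → G.Node :=
  Sum.map σ.hom.vertexMap (Sum.map σ.hom.edgeMap σ.hom.branchMap)

/-- `Γ` *acts trivially* on a sub-semi-graph `H` via `ρ`: it fixes every vertex and edge of `H` and
every branch of an edge of `H`. [cite: MochizukiSemiAnbd2006, Lem. 1.8(ii) p.20] -/
def Subgraph.IsFixedPointwise (H : G.Subgraph) (ρ : Γ →* Aut G) : Prop :=
  ∀ γ : Γ, (∀ v ∈ H.verts, (ρ γ).hom.vertexMap v = v) ∧ (∀ e ∈ H.edges, (ρ γ).hom.edgeMap e = e) ∧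
    ∀ b : G.Branch, G.edgeOf b ∈ H.edges → (ρ γ).hom.branchMap b = b

variable (G Γ)

/-- NAMED FACT, [SemiAnbd] Lemma 1.8 (i): `G` a connected semi-graph with an action of a finite group
`Γ`; "every finite sub-semi-graph `G'` of `G` is contained in a finite connected sub-semi-graph `G''`
of `G` that is stabilized by the action of `Γ`." [cite: MochizukiSemiAnbd2006, Lem. 1.8(i) p.20] -/
def lemma_1_8_i : Prop :=
  ∀ (G : SemiGraph.{u}) (Γ : Type u) [Group Γ] [Finite Γ] (ρ : Γ →* Aut G), G.IsConnected →
    ∀ H : G.Subgraph, H.IsFinite → ∃ H' : G.Subgraph, H'.IsFinite ∧ H'.toSemiGraph.IsConnected ∧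
      H.IsContainedIn H' ∧ H'.IsStabilized ρ

/-- NAMED FACT, [SemiAnbd] Lemma 1.8 (ii)(a): `G` a tree with an action of a finite group `Γ`; "there
exists at least one vertex or edge of `G` that is fixed by `Γ`."
[cite: MochizukiSemiAnbd2006, Lem. 1.8(ii)(a) p.20] -/
def lemma_1_8_ii_a : Prop :=
  ∀ (G : SemiGraph.{u}) (Γ : Type u) [Group Γ] [Finite Γ] (ρ : Γ →* Aut G), G.IsTree →
    (∃ v : G.Vertex, ∀ γ, (ρ γ).hom.vertexMap v = v) ∨ ∃ e : G.Edge, ∀ γ, (ρ γ).hom.edgeMap e = e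

/-- NAMED FACT, [SemiAnbd] Lemma 1.8 (ii)(b): `G` a tree with an action of a finite group `Γ`; "if `Γ`
fixes two distinct vertices `w_1`, `w_2` of `G`, then `Γ` acts trivially on any “geodesic” [i.e., path
of closed edges of minimal length] that joins `w_1`, `w_2`" — a geodesic being a walk of minimal
length in the barycentric subdivision. [cite: MochizukiSemiAnbd2006, Lem. 1.8(ii)(b) p.20] -/
def lemma_1_8_ii_b : Prop :=
  ∀ (G : SemiGraph.{u}) (Γ : Type u) [Group Γ] [Finite Γ] (ρ : Γ →* Aut G), G.IsTree →
    ∀ w₁ w₂ : G.Vertex, w₁ ≠ w₂ → (∀ γ, (ρ γ).hom.vertexMap w₁ = w₁) →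
      (∀ γ, (ρ γ).hom.vertexMap w₂ = w₂) →
      ∀ p : G.subdivision.Walk (Sum.inl w₁) (Sum.inl w₂),
        p.length = G.subdivision.dist (Sum.inl w₁) (Sum.inl w₂) →
        ∀ x ∈ p.support, ∀ γ, nodeMap (ρ γ) x = x

/-- NAMED FACT, [SemiAnbd] Lemma 1.8 (ii)(c): `G` a tree with an action of a finite group `Γ`; "if `Γ`
fixes three distinct vertices of `G`, then there exists at least one subjoint of `G` on which `Γ` acts
trivially." [cite: MochizukiSemiAnbd2006, Lem. 1.8(ii)(c) p.20] -/
def lemma_1_8_ii_c : Prop :=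
  ∀ (G : SemiGraph.{u}) (Γ : Type u) [Group Γ] [Finite Γ] (ρ : Γ →* Aut G), G.IsTree →
    ∀ w₁ w₂ w₃ : G.Vertex, w₁ ≠ w₂ → w₂ ≠ w₃ → w₁ ≠ w₃ →
      (∀ γ, (ρ γ).hom.vertexMap w₁ = w₁) → (∀ γ, (ρ γ).hom.vertexMap w₂ = w₂) →
      (∀ γ, (ρ γ).hom.vertexMap w₃ = w₃) →
      ∃ H : G.Subgraph, H.IsSubjoint ∧ H.IsFixedPointwise ρ

end SemiGraph

/-- [SemiAnbd] Remark 1.8.1 ([Serre] I.3.4, Theorem 5): "a free group … does not contain any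
nontrivial finite subgroups" — PROVED from the torsion-freeness of free groups (Mathlib).
[cite: MochizukiSemiAnbd2006, Rem. 1.8.1 p.21] -/
theorem remark_1_8_1 {ι : Type u} (H : Subgroup (FreeGroup ι)) [Finite H] : H = ⊥ := by
  rw [Subgroup.eq_bot_iff_forall]
  intro x hx
  have hcard : 0 < Nat.card H := Nat.card_pos
  have h1 : (⟨x, hx⟩ : H) ^ Nat.card H = 1 := pow_card_eq_one'
  have h2 : x ^ Nat.card H = (1 : FreeGroup ι) ^ Nat.card H := by
    rw [one_pow]
    exact congrArg Subtype.val h1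
  exact pow_left_injective hcard.ne' h2

end Literature.AnabelianGeometry.SemiGraphs
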